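import Summits.NavierStokesRegularity.OSWSelfSimilar.OSWMechanismGlobalBranch04
import HarnessLib

/-!
# OSW self-similar mechanism, companion module (MECHANISM.md §§29–34: THEOREMS M32–M39) — part 05 of 09

1-D model (gCLM/OSW), computer-assisted; not Euler/NS.  Filed under `Summits/NavierStokesRegularity/OSWSelfSimilar/` by a prover-role courier on behalf of the
mechanism seat pub-oswblow-mech (planner-pub-oswblow-mech-g29-0), cell pub-oswblow (host summit NavierStokesRegularity); the gate admits the path but
not role planner.  CONTENT = the staged transcript `pub-oswblow-mech/lean/OSWMechanismGlobalBranch.lean` (sha256 4e5de3f87ec94598…,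
2998 lines), source lines 1478–1843, UNCHANGED except: (i) namespace prefix `OSWSelfSimilar.Mechanism` → `Summit.NavierStokesRegularity.OSWSelfSimilar.Mechanism`;
(ii) the frames open at the cut (section (anonymous) › namespace Summit.NavierStokesRegularity.OSWSelfSimilar.Mechanism.SourceDefect) are re-opened above the body with their `open` commands replayed, and closed
at the end; (iii) this docstring.  Generated by `pub-oswblow-mech/lean/courier/make_split.py`; the parts must be filed IN ORDER
(each imports its predecessor).  First/last declarations here: `location_alg` … `one_sub_cos_eq` (34 in this part).
AI-written transcript; kernel-checked on the farm as ONE file before splitting (see the kit's CHECKS); to be checked, not trusted.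
COURIER NOTE (prover-role courier seat pub-oswblow-courier g2, 2026-08-25): in addition to the changes listed above, 1 one-line docstrings were added at filing on the declarations the transcript left undocumented (tree docstring rule); each only restates the formal statement of its declaration; nothing else was touched. List of the added docstrings: HOME `pub-oswblow-courier/g2/DOCSTRINGS.tsv`.
-/

noncomputable section
open Complex Set Filter
open scoped Topology
open Literature.Analysis.FluidPDE.OkamotoSakajoWunsch2008
namespace Summit.NavierStokesRegularity.OSWSelfSimilar.Mechanism.SourceDefect
open Summit.NavierStokesRegularity.OSWSelfSimilar.Mechanism.GlobalBranch Summit.NavierStokesRegularity.OSWSelfSimilar.Mechanism.ChordSlope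

/-- (ii): the budget `πA₀ ≥ 2F₀(log(x₀/x_m) − log(π/2))` gives `x_m ≥ (2/π)x₀·exp(−πA₀/(2F₀))`. -/
theorem location_alg (A0 F0 x0 xm : ℝ) (_hA0 : 0 < A0) (hF0 : 0 < F0) (hx0 : 0 < x0) (hxm : 0 < xm)
    (h : 2 * F0 * (Real.log (x0 / xm) - Real.log (Real.pi / 2)) ≤ Real.pi * A0) :
    2 / Real.pi * x0 * Real.exp (-(Real.pi * A0 / (2 * F0))) ≤ xm := by
  have hπ := Real.pi_pos
  have h1 : Real.log (x0 / xm) ≤ Real.log (Real.pi / 2) + Real.pi * A0 / (2 * F0) := by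
    have : Real.log (x0 / xm) - Real.log (Real.pi / 2) ≤ Real.pi * A0 / (2 * F0) := by
      rw [le_div_iff₀ (by positivity)]; linarith
    linarith
  have h2 := Real.exp_le_exp.mpr h1
  rw [Real.exp_log (by positivity), Real.exp_add, Real.exp_log (by positivity)] at h2
  -- x0/xm ≤ (π/2) exp(πA0/(2F0))  ⇒  (2/π) x0 exp(-πA0/(2F0)) ≤ xm
  have hE := Real.exp_pos (Real.pi * A0 / (2 * F0))
  have h3 : x0 ≤ xm * (Real.pi / 2 * Real.exp (Real.pi * A0 / (2 * F0))) := by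
    have := (div_le_iff₀ hxm).mp h2; linarith
  rw [Real.exp_neg]
  have h4 : 2 / Real.pi * x0 * (Real.exp (Real.pi * A0 / (2 * F0)))⁻¹
      = x0 / (Real.pi / 2 * Real.exp (Real.pi * A0 / (2 * F0))) := by
    field_simp
  rw [h4, div_le_iff₀ (by positivity)]
  exact h3

/-- (iii): `C₀x_m ≤ T·K`, `K ≤ (π/2)A₀`, `0 < X ≤ x_m` ⇒ `C₀ ≤ T(π/2)A₀/X`. -/
theorem slope_bound_S1_alg (C0 xm T K A0 X : ℝ) (hT : 0 ≤ T) (hA0 : 0 < A0) (hX : 0 < X) (hXxm : X ≤ xm)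
    (h1 : C0 * xm ≤ T * K) (h2 : K ≤ Real.pi / 2 * A0) : C0 ≤ T * (Real.pi / 2) * A0 / X := by
  have hxm : 0 < xm := lt_of_lt_of_le hX hXxm
  rw [le_div_iff₀ hX]
  have h3 : T * K ≤ T * (Real.pi / 2 * A0) := mul_le_mul_of_nonneg_left h2 hT
  by_cases hC : 0 ≤ C0
  · have : C0 * X ≤ C0 * xm := mul_le_mul_of_nonneg_left hXxm hC
    nlinarith
  · push Not at hC
    have : C0 * X < 0 := mul_neg_of_neg_of_pos hC hX
    have : 0 ≤ T * (Real.pi / 2) * A0 := by positivity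
    linarith

/-- COROLLARY 31.5 (c): `C₀x_m ≤ T·K_m`, `K_m ≤ (π/2)A₀`, `(1−a)A₀ = 1`, `a < 1` ⇒ `(1−a)C₀x_m ≤ (π/2)T`. -/
theorem first_bump_runs_in_alg (C0 xm T Km A0 a : ℝ) (hT : 0 ≤ T) (ha : a < 1) (hq : (1 - a) * A0 = 1)
    (h1 : C0 * xm ≤ T * Km) (h2 : Km ≤ Real.pi / 2 * A0) : (1 - a) * (C0 * xm) ≤ Real.pi / 2 * T := by
  have h1a : 0 < 1 - a := by linarith
  have h3 : T * Km ≤ T * (Real.pi / 2 * A0) := mul_le_mul_of_nonneg_left h2 hT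
  have : (1 - a) * (C0 * xm) ≤ (1 - a) * (T * (Real.pi / 2 * A0)) :=
    mul_le_mul_of_nonneg_left (h1.trans h3) h1a.le
  calc (1 - a) * (C0 * xm) ≤ (1 - a) * (T * (Real.pi / 2 * A0)) := this
    _ = Real.pi / 2 * T * ((1 - a) * A0) := by ring
    _ = Real.pi / 2 * T := by rw [hq, mul_one]

/-! ### §31 typed: the classes `𝒮`, `𝒮₁`, the first critical point, THEOREM M34 / M35 as named statements, and the
kernel-checked spines (COROLLARY 31.5 (a): the ladder in `𝒮₁`; REMARK 31.6 (3)(α): no needle + a floor for the first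
critical point ⇒ (29.10) in `𝒮`). -/

/-- The monotone shape class `𝒮`, typed on `u = F/sin x` (`F = −f > 0` on `(0,π)`, `u` non-increasing). -/
def InS (c : ℤ → ℂ) : Prop :=
  (∀ x ∈ Set.Ioo 0 Real.pi, 0 < -fR c x) ∧ AntitoneOn (fun x => -fR c x / Real.sin x) (Set.Ioo 0 Real.pi)

/-- `𝒮_LC ⊂ 𝒮` (the first two clauses of `InSLC`). -/
theorem inS_of_inSLC {c : ℤ → ℂ} (h : InSLC c) : InS c := ⟨h.1, h.2.1⟩

/-- `x_m` is the FIRST critical point of `F = −f`: the first zero of `Hf − 1` (`a g F′ = F(Hf − 1)` by (T1)), i.e.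
`Hf > 1` on `(0, x_m)` and `Hf(x_m) = 1`. -/
def IsFirstCrit (c : ℤ → ℂ) (xm : ℝ) : Prop :=
  0 < xm ∧ xm < Real.pi ∧ HfR c xm = 1 ∧ ∀ x : ℝ, 0 < x → x < xm → 1 < HfR c x

/-- The SINGLE-CROSSING class `𝒮₁ ⊂ 𝒮`: `Hf − 1` has exactly one (transversal) zero on `(0,π)` — `F` is unimodal. -/
def InS1 (c : ℤ → ℂ) : Prop :=
  InS c ∧ ∃ xm : ℝ, IsFirstCrit c xm ∧ ∀ x : ℝ, xm < x → x < Real.pi → HfR c x < 1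

/-- The constant of THEOREM M34: `T(a) = π·exp(π/(c₆a))`, `c₆ = 5 log 2/(7C₅)`, `C₅ = π/2 + 6`, i.e.
`T(a) = π·exp(7π(π/2 + 6)/(5 log 2 · a))` (`= π·e^{48.04/a}`). -/
def noNeedleT (a : ℝ) : ℝ := Real.pi * Real.exp (7 * Real.pi * (Real.pi / 2 + 6) / (5 * Real.log 2) / a)

/-- `0 < T(a)` for the constant `noNeedleT a = π·exp(7π(π/2 + 6)/(5 log 2·a))` of THEOREM M34. -/
theorem noNeedleT_pos (a : ℝ) : 0 < noNeedleT a := by unfold noNeedleT; positivity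

/-- `T(a) ≤ e^{50/a}` for `0 < a ≤ 1` (kernel-checked numerics: `T_le_exp`, `exponent_lt_fifty`). -/
theorem noNeedleT_le (a : ℝ) (ha : 0 < a) (ha1 : a ≤ 1) : noNeedleT a ≤ Real.exp (50 / a) := by
  unfold noNeedleT
  set c := 7 * Real.pi * (Real.pi / 2 + 6) / (5 * Real.log 2) with hc
  have hcpos : 0 ≤ c := by
    rw [hc]; have := Real.log_two_gt_d9; have := Real.pi_pos; positivity
  have h1 := T_le_exp c a hcpos ha ha1
  have h2 : (c + 3 / 2) / a ≤ 50 / a := by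
    apply div_le_div_of_nonneg_right _ ha.le
    have := exponent_lt_fifty; rw [← hc] at this; linarith
  exact h1.trans (Real.exp_le_exp.mpr h2)

/-- On the window `3/5 < a < 1`: `T(a) ≤ e^{250/3}`. -/
theorem noNeedleT_le_window (a : ℝ) (ha : 3 / 5 < a) (ha1 : a < 1) : noNeedleT a ≤ Real.exp (250 / 3) := by
  have h := noNeedleT_le a (by linarith) ha1.le
  apply h.trans (Real.exp_le_exp.mpr _)
  rw [div_le_iff₀ (by linarith)]; nlinarith

/-- **THEOREM 31.3 = THEOREM M34, typed (PROVED pen-and-paper, MECHANISM.md §31.3; NO NEEDLE in `𝒮`):** for a negative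
class-(H) profile with `q₀ = 1` in `𝒮` and its first critical point `x_m`, the chord slope is at most `T(a)·F(x_m)/x_m`
(in `𝒮` the chord slope is `|f′(0)|`; the pen-and-paper statement adds `F(x_m) ≥ min{|f′(0)|x_m/4, a·Hf(0)/31}`).
Kernel-checked pieces: `defect_exponent`, `localExponent_eq`, `neg_log_one_sub_le_two_mul`, `cos_sub_cos_ge_jordan`,
`cos_sub_cos_le_half_sq_sub`, `tu_coefficient_lt_six`, `half_retention_alg`, `else_branch_alg`, `climb_alg`, `tm_bound`. -/
def NoNeedleStatement (NegP : ℝ → (ℤ → ℂ) → Prop) : Prop :=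
  ∀ (a : ℝ) (c : ℤ → ℂ), NegP a c → (1 - a) * HfR c 0 = 1 → 3 / 5 < a → a < 1 → InS c →
    ∀ xm : ℝ, IsFirstCrit c xm → ChordBound c (noNeedleT a * (-fR c xm) / xm)

/-- **THEOREM 31.4 = THEOREM M35, typed (PROVED pen-and-paper, MECHANISM.md §31.4): (29.10) HOLDS IN `𝒮₁`** — for
`a ≤ a₂ < 1` and `|Hf(π)| ≥ b > 0` the chord slope of a single-crossing profile is bounded by a constant `Ψ₁♯(a₂,b)`.
Kernel-checked pieces: `sink_floor_alg`, `x0_sq_lt`, `location_alg`, `slope_bound_S1_alg`. -/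
def SlopeBoundS1Statement (NegP : ℝ → (ℤ → ℂ) → Prop) : Prop :=
  ∀ a₂ b : ℝ, 3 / 5 < a₂ → a₂ < 1 → 0 < b → ∃ C : ℝ, ∀ (a : ℝ) (c : ℤ → ℂ), NegP a c → (1 - a) * HfR c 0 = 1 →
    3 / 5 < a → a ≤ a₂ → b ≤ -HfR c Real.pi → InS1 c → ChordBound c C

/-- LEMMA 28.2 (b), typed (PROVED pen-and-paper): log-concave profiles are unimodal — `𝒮_LC ⊂ 𝒮₁`. -/
def LCsubS1Statement (NegP : ℝ → (ℤ → ℂ) → Prop) : Prop :=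
  ∀ (a : ℝ) (c : ℤ → ℂ), NegP a c → (1 - a) * HfR c 0 = 1 → 3 / 5 < a → a < 1 → InSLC c → InS1 c

/-- KERNEL-CHECKED: THEOREM M35 contains THEOREM 30.7 (given LEMMA 28.2 (b)). -/
theorem slopeBoundLC_of_S1 {NegP : ℝ → (ℤ → ℂ) → Prop} (h : SlopeBoundS1Statement NegP) (hLC : LCsubS1Statement NegP) :
    SlopeBoundLCStatement NegP := by
  intro a₂ b ha₂ ha₂' hb
  obtain ⟨C, hC⟩ := h a₂ b ha₂ ha₂' hb
  exact ⟨C, fun a c hN hq ha haa hB hS => hC a c hN hq ha haa hB (hLC a c hN hq ha (lt_of_le_of_lt haa ha₂') hS)⟩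

/-- **COROLLARY 31.5 (a), KERNEL-CHECKED:** along a branch family with divergent chord slope which is eventually in `𝒮₁`
with `a ≤ a₂ < 1`, THEOREM M35 puts every odd rung `P = 2n+3` on the branch. -/
theorem _root_.Summit.NavierStokesRegularity.OSWSelfSimilar.Mechanism.GlobalBranch.BranchFamily.ladder_in_S1 {NegP : ℝ → (ℤ → ℂ) → Prop} {β : NNReal} {aσ : ℝ → ℝ} {cσ : ℝ → ℤ → ℂ}
    (hF : BranchFamily NegP β aσ cσ) (hdiv : ChordSlopeDiverges aσ cσ) (hT : SlopeBoundS1Statement NegP)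
    (a₂ σ₁ : ℝ) (ha₂ : 3 / 5 < a₂) (ha₂' : a₂ < 1)
    (hev : ∀ σ : ℝ, σ₁ < σ → 0 < σ → aσ σ ≤ a₂ ∧ InS1 (cσ σ)) (n : ℕ) :
    ∃ σ : ℝ, 0 < σ ∧ NegP (aσ σ) (cσ σ) ∧ (1 - aσ σ) * HfR (cσ σ) 0 = 1 ∧
      HfR (cσ σ) Real.pi = -(1 / (aσ σ * (2 * (n : ℝ) + 3) - 1)) := by
  apply hF.ladder_of_slope_bound hdiv _ n
  intro b hb
  obtain ⟨C, hC⟩ := hT a₂ b ha₂ ha₂' hb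
  refine ⟨|C|, σ₁, fun σ hσ hσ0 hB => ?_⟩
  have hwin := hF.window σ hσ0
  obtain ⟨ha, hS⟩ := hev σ hσ hσ0
  have hcb : ChordBound (cσ σ) C :=
    hC (aσ σ) (cσ σ) (hF.profile σ hσ0) (hF.source σ hσ0) hwin.1 ha hB hS
  apply chordBound_mono hcb
  have h1a : 0 < 1 - aσ σ := by linarith [hwin.2]
  have h1b : 1 - aσ σ ≤ 1 := by linarith [hwin.1]
  calc C ≤ |C| := le_abs_self C
    _ = |C| / 1 := (div_one _).symm
    _ ≤ |C| / (1 - aσ σ) := div_le_div_of_nonneg_left (abs_nonneg C) h1a h1b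

/-- (22.9), typed (PROVED pen-and-paper, M27 (ii)): `K = max F ≤ (π/2)·Hf(0)` for negative profiles in `𝒮′ ⊃ 𝒮`. -/
def AmplitudeBoundStatement (NegP : ℝ → (ℤ → ℂ) → Prop) : Prop :=
  ∀ (a : ℝ) (c : ℤ → ℂ), NegP a c → (1 - a) * HfR c 0 = 1 → InS c → ∀ x : ℝ, -fR c x ≤ Real.pi / 2 * HfR c 0

/-- **QUESTION 31.7 (a), typed — OPEN:** a floor `ξ(a₂,b) > 0` for the FIRST critical point of `F` on
`𝒮 ∩ {a ≤ a₂, |Hf(π)| ≥ b}`. -/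
def FirstCritFloorConjecture (NegP : ℝ → (ℤ → ℂ) → Prop) : Prop :=
  ∀ a₂ b : ℝ, 3 / 5 < a₂ → a₂ < 1 → 0 < b → ∃ ξ : ℝ, 0 < ξ ∧ ∀ (a : ℝ) (c : ℤ → ℂ), NegP a c → (1 - a) * HfR c 0 = 1 →
    3 / 5 < a → a ≤ a₂ → b ≤ -HfR c Real.pi → InS c → ∀ xm : ℝ, IsFirstCrit c xm → ξ ≤ xm

/-- (29.10) in the whole monotone class, typed (= QUESTION 30.10 (a) in `𝒮`; OPEN). -/
def SlopeBoundSStatement (NegP : ℝ → (ℤ → ℂ) → Prop) : Prop :=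
  ∀ a₂ b : ℝ, 3 / 5 < a₂ → a₂ < 1 → 0 < b → ∃ C : ℝ, ∀ (a : ℝ) (c : ℤ → ℂ), NegP a c → (1 - a) * HfR c 0 = 1 →
    3 / 5 < a → a ≤ a₂ → b ≤ -HfR c Real.pi → InS c → (∃ xm : ℝ, IsFirstCrit c xm) → ChordBound c C

/-- **REMARK 31.6 (3)(α), KERNEL-CHECKED reduction:** NO NEEDLE (M34) + a floor for the first critical point
(QUESTION 31.7 (a)) + the amplitude bound (22.9) ⇒ (29.10) on `𝒮`, with `C = e^{250/3}·(π/2)·(1/(1−a₂))/ξ`. -/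
theorem slopeBoundS_of_noNeedle_floor {NegP : ℝ → (ℤ → ℂ) → Prop} (hN : NoNeedleStatement NegP)
    (hξ : FirstCritFloorConjecture NegP) (hK : AmplitudeBoundStatement NegP) : SlopeBoundSStatement NegP := by
  intro a₂ b ha₂ ha₂' hb
  obtain ⟨ξ, hξpos, hξb⟩ := hξ a₂ b ha₂ ha₂' hb
  refine ⟨Real.exp (250 / 3) * (Real.pi / 2) * (1 / (1 - a₂)) / ξ, ?_⟩
  intro a c hNP hq ha haa hB hS hex
  obtain ⟨xm, hxm⟩ := hex
  have hcb := hN a c hNP hq ha (lt_of_le_of_lt haa ha₂') hS xm hxm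
  have hfloor := hξb a c hNP hq ha haa hB hS xm hxm
  apply chordBound_mono hcb
  -- noNeedleT a * F(xm) / xm ≤ e^{250/3} (π/2) (1/(1-a₂)) / ξ
  have h1a : 0 < 1 - a := by linarith
  have hA0 : HfR c 0 = 1 / (1 - a) := by field_simp; linarith [hq]
  have hFxm : -fR c xm ≤ Real.pi / 2 * (1 / (1 - a)) := by rw [← hA0]; exact hK a c hNP hq hS xm
  have hA2 : 1 / (1 - a) ≤ 1 / (1 - a₂) := by
    apply div_le_div_of_nonneg_left (by norm_num) (by linarith) (by linarith)
  have hT := noNeedleT_le_window a ha (lt_of_le_of_lt haa ha₂')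
  have hTpos := noNeedleT_pos a
  have hxmpos : 0 < xm := hxm.1
  have hFpos : 0 < -fR c xm := hS.1 xm ⟨hxm.1, hxm.2.1⟩
  have num : noNeedleT a * (-fR c xm) ≤ Real.exp (250 / 3) * (Real.pi / 2) * (1 / (1 - a₂)) := by
    calc noNeedleT a * (-fR c xm) ≤ Real.exp (250 / 3) * (Real.pi / 2 * (1 / (1 - a))) :=
          mul_le_mul hT hFxm hFpos.le (Real.exp_pos _).le
      _ ≤ Real.exp (250 / 3) * (Real.pi / 2 * (1 / (1 - a₂))) := by
          apply mul_le_mul_of_nonneg_left _ (Real.exp_pos _).le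
          exact mul_le_mul_of_nonneg_left hA2 (by positivity)
      _ = Real.exp (250 / 3) * (Real.pi / 2) * (1 / (1 - a₂)) := by ring
  have hRpos : 0 ≤ Real.exp (250 / 3) * (Real.pi / 2) * (1 / (1 - a₂)) := by
    have : 0 < 1 - a₂ := by linarith
    positivity
  calc noNeedleT a * (-fR c xm) / xm ≤ Real.exp (250 / 3) * (Real.pi / 2) * (1 / (1 - a₂)) / xm :=
        div_le_div_of_nonneg_right num hxmpos.le
    _ ≤ Real.exp (250 / 3) * (Real.pi / 2) * (1 / (1 - a₂)) / ξ :=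
        div_le_div_of_nonneg_left hRpos hξpos hfloor

/-- **The v25 bundle of this module's §31 block:** M34 ∧ M35 ∧ (𝒮_LC ⊂ 𝒮₁) ∧ (22.9), typed shadows, parametric in `NegP`;
`FirstCritFloorConjecture` stays OUTSIDE the bundle (open). -/
def SourceDefectBundle (NegP : ℝ → (ℤ → ℂ) → Prop) : Prop :=
  NoNeedleStatement NegP ∧ SlopeBoundS1Statement NegP ∧ LCsubS1Statement NegP ∧ AmplitudeBoundStatement NegP

/-- v25 headline reduction (kernel-checked): with the v24 bundle, M33's divergence holds on a branch family for every `β`,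
and an eventually single-crossing tail with `a ≤ a₂ < 1` carries EVERY rung (COROLLARY 31.5 (a)); and the v25 bundle
with the open floor (QUESTION 31.7 (a)) gives (29.10) on `𝒮` (REMARK 31.6 (3)(α)). -/
theorem ladder_of_v25 {NegP : ℝ → (ℤ → ℂ) → Prop} (h24 : ChordSlopeBundle NegP) (h25 : SourceDefectBundle NegP) :
    (∀ β : NNReal, 0 < β → β < 1 → ∃ (aσ : ℝ → ℝ) (cσ : ℝ → ℤ → ℂ), BranchFamily NegP β aσ cσ ∧
      ChordSlopeDiverges aσ cσ ∧
      ∀ a₂ σ₁ : ℝ, 3 / 5 < a₂ → a₂ < 1 → (∀ σ : ℝ, σ₁ < σ → 0 < σ → aσ σ ≤ a₂ ∧ InS1 (cσ σ)) →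
        ∀ n : ℕ, ∃ σ : ℝ, 0 < σ ∧ NegP (aσ σ) (cσ σ) ∧ (1 - aσ σ) * HfR (cσ σ) 0 = 1 ∧
          HfR (cσ σ) Real.pi = -(1 / (aσ σ * (2 * (n : ℝ) + 3) - 1))) ∧
    (FirstCritFloorConjecture NegP → SlopeBoundSStatement NegP) := by
  refine ⟨?_, fun hξ => slopeBoundS_of_noNeedle_floor h25.1 hξ h25.2.2.2⟩
  intro β hβ0 hβ1
  obtain ⟨aσ, cσ, hF, hdiv⟩ := chordSlopeDivergence_of h24.2.2.2 h24.1 β hβ0 hβ1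
  exact ⟨aσ, cσ, hF, hdiv, fun a₂ σ₁ ha₂ ha₂' hev n => hF.ladder_in_S1 hdiv h25.2.1 a₂ σ₁ ha₂ ha₂' hev n⟩

end Summit.NavierStokesRegularity.OSWSelfSimilar.Mechanism.SourceDefect


/-! ## §32 (v26): the first critical point cannot run into the source — LEMMA 32.1 (velocity–budget sandwich),
LEMMA 32.2 (octave transport), LEMMA 32.3 (the tangent reaches height), PROPOSITION 32.4 (limits of monotone profiles,
NO OVERSHOOT), THEOREM M36 ((29.10) in all of 𝒮; QUESTION 31.7 (a): YES), COROLLARY 32.6, REMARK 32.7, QUESTION 32.8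
(MECHANISM.md v26 §32).  1-D model (gCLM/OSW), computer-assisted; not Euler/NS. -/

namespace Summit.NavierStokesRegularity.OSWSelfSimilar.Mechanism.FirstCritFloor

open Summit.NavierStokesRegularity.OSWSelfSimilar.Mechanism.GlobalBranch Summit.NavierStokesRegularity.OSWSelfSimilar.Mechanism.ChordSlope Summit.NavierStokesRegularity.OSWSelfSimilar.Mechanism.SourceDefect
open Finset

/-! ### LEMMA 32.1: trigonometric inequalities and bookkeeping -/

/-- `x/2 ≤ tan(x/2)` on `(0,π)`. -/
theorem half_le_tan_half (x : ℝ) (h0 : 0 < x) (hπ : x < Real.pi) : x / 2 ≤ Real.tan (x / 2) :=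
  Real.le_tan (by linarith) (by linarith)

/-- `x·cot(x/2) ≤ 2` on `(0,π)` in the form `x·cos(x/2) ≤ 2·sin(x/2)` (so `x·G(x) = F(x)·x·cot(x/2) ≤ 2F(x)`). -/
theorem x_mul_cos_half_le_two_sin_half (x : ℝ) (h0 : 0 < x) (hπ : x < Real.pi) :
    x * Real.cos (x / 2) ≤ 2 * Real.sin (x / 2) := by
  have hc : 0 < Real.cos (x / 2) := Real.cos_pos_of_mem_Ioo ⟨by linarith, by linarith⟩
  have ht := half_le_tan_half x h0 hπ
  rw [Real.tan_eq_sin_div_cos, le_div_iff₀ hc] at ht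
  linarith

/-- The kernel slope of (17.1): `∂ₓΛ(x,y) = sin y/(cos x − cos y) ≥ (1 + cos y)/sin y = cot(y/2)` for `0 < x < y < π`. -/
theorem kernel_slope_ge_cot_half (x y : ℝ) (hx : 0 < x) (hxy : x < y) (hy : y < Real.pi) :
    (1 + Real.cos y) / Real.sin y ≤ Real.sin y / (Real.cos x - Real.cos y) := by
  have hsy : 0 < Real.sin y := Real.sin_pos_of_pos_of_lt_pi (by linarith) hy
  have hcc : Real.cos y < Real.cos x := Real.cos_lt_cos_of_nonneg_of_le_pi hx.le hy.le hxy
  have hd : 0 < Real.cos x - Real.cos y := by linarith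
  rw [div_le_div_iff₀ hsy hd]
  have h1 := Real.sin_sq_add_cos_sq y
  have h2 := Real.cos_le_one x
  have h3 := Real.neg_one_le_cos y
  nlinarith [h1, h2, h3, mul_nonneg (by linarith : (0:ℝ) ≤ 1 + Real.cos y) (by linarith : (0:ℝ) ≤ 1 - Real.cos x)]

/-- LEMMA 32.1 (b), the upper half: `g ≤ ∫₀ˣR + (1/π)∫₀ˣyG`, `∫₀ˣR = xR + (1/π)∫₀ˣyG`, `∫₀ˣ yG ≤ 2m` ⇒ `g ≤ xR + (4/π)m`. -/
theorem velocity_upper_alg (g intR IyG m x R : ℝ) (h1 : g ≤ intR + IyG / Real.pi)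
    (h2 : intR = x * R + IyG / Real.pi) (h3 : IyG ≤ 2 * m) : g ≤ x * R + 4 / Real.pi * m := by
  have hπ := Real.pi_pos
  have : IyG / Real.pi ≤ 2 * m / Real.pi := div_le_div_of_nonneg_right h3 hπ.le
  have e : 4 / Real.pi * m = 2 * m / Real.pi + 2 * m / Real.pi := by field_simp; ring
  rw [e]; linarith

/-- LEMMA 32.1 (c): `∫_yˣ(h − R) = E(x) − E(y) − S` with `0 ≤ E ≤ (4/π)m`, `0 ≤ S ≤ (2/π)(m(x) − m(y))`, `0 ≤ m(y) ≤ m(x)`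
gives `|∫_yˣ(h − R)| ≤ (4/π)m(x)`. -/
theorem avg_strain_alg (Ex Ey S mx my : ℝ) (hEx : 0 ≤ Ex) (hEx' : Ex ≤ 4 / Real.pi * mx) (hEy : 0 ≤ Ey)
    (hEy' : Ey ≤ 4 / Real.pi * my) (hS : 0 ≤ S) (hS' : S ≤ 2 / Real.pi * (mx - my)) (hm : my ≤ mx) :
    |Ex - Ey - S| ≤ 4 / Real.pi * mx := by
  have hπ := Real.pi_pos
  have hπ' : 0 < 4 / Real.pi := by positivity
  rw [abs_le]; constructor
  · have : 4 / Real.pi * my + 2 / Real.pi * (mx - my) ≤ 4 / Real.pi * mx := by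
      have e : 4 / Real.pi * mx - (4 / Real.pi * my + 2 / Real.pi * (mx - my)) = 2 / Real.pi * (mx - my) := by ring
      have : 0 ≤ 2 / Real.pi * (mx - my) := by positivity
      nlinarith
    linarith
  · linarith

/-! ### LEMMA 32.2: octave transport -/

/-- LEMMA 32.2 (a), the final algebra: `(1/a)[(2θX − (4/π)m)/(2A₀X) − (6/π)m/X] = θ/(aA₀) − c_g·m/(aX)`,
`c_g = (6 + 2/A₀)/π`. -/
theorem octave_growth_alg (a A0 X θ m : ℝ) (ha : 0 < a) (hA0 : 0 < A0) (hX : 0 < X) :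
    1 / a * ((2 * θ * X - 4 / Real.pi * m) / (2 * A0 * X) - 6 / Real.pi * m / X)
      = θ / (a * A0) - (6 + 2 / A0) / Real.pi * (m / (a * X)) := by
  have hπ := Real.pi_pos
  field_simp; ring

/-- LEMMA 32.2 (b): `log(F(2X)/F(X)) ≥ −Φ/(aX)`, `Φ ≤ (6/π)m`, `m ≤ 2X·S`, `S ≤ (π/2)A₀` ⇒ `≥ −6A₀/a`. -/
theorem octave_loss_alg (L Φ m X S A0 a : ℝ) (ha : 0 < a) (hX : 0 < X) (hA0 : 0 < A0)
    (hL : -(Φ / (a * X)) ≤ L) (hΦ : Φ ≤ 6 / Real.pi * m) (hm : m ≤ 2 * X * S) (hS : S ≤ Real.pi / 2 * A0) :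
    -(6 * A0 / a) ≤ L := by
  have hπ := Real.pi_pos
  have h1 : Φ ≤ 6 / Real.pi * (2 * X * (Real.pi / 2 * A0)) := by
    calc Φ ≤ 6 / Real.pi * m := hΦ
      _ ≤ 6 / Real.pi * (2 * X * S) := by gcongr
      _ ≤ 6 / Real.pi * (2 * X * (Real.pi / 2 * A0)) := by gcongr
  have e : 6 / Real.pi * (2 * X * (Real.pi / 2 * A0)) = 6 * A0 * X := by field_simp
  rw [e] at h1
  have h2 : Φ / (a * X) ≤ 6 * A0 * X / (a * X) := div_le_div_of_nonneg_right h1 (by positivity)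
  have e2 : 6 * A0 * X / (a * X) = 6 * A0 / a := by field_simp
  rw [e2] at h2
  linarith

/-- LEMMA 32.2 (c): `cot(s/2) ≥ 1.8/s` on `(0, 1/2]`, in the form `1.8·sin(s/2) ≤ s·cos(s/2)`. -/
theorem cot_half_ge (s : ℝ) (h0 : 0 < s) (h1 : s ≤ 1 / 2) :
    (9 / 5) * Real.sin (s / 2) ≤ s * Real.cos (s / 2) := by
  have hs : Real.sin (s / 2) ≤ s / 2 := Real.sin_le (by linarith)
  have hc : 1 - (s / 2) ^ 2 / 2 ≤ Real.cos (s / 2) := Real.one_sub_sq_div_two_le_cos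
  nlinarith [hs, hc, h0, h1, mul_pos h0 h0]

/-- LEMMA 32.2 (c), the count: `N·λ/4 ≤ ∫m/s² ≤ (π/1.8)·B(x̄)` ⇒ `N ≤ 7B/λ` (`4π/1.8 < 7`). -/
theorem heavy_count_alg (N lam I B : ℝ) (hlam : 0 < lam) (hB : 0 ≤ B) (hcount : N * (lam / 4) ≤ I)
    (hI : I ≤ Real.pi / (9 / 5) * B) : N ≤ 7 * B / lam := by
  have hπ := Real.pi_lt_d2
  have h1 : N * (lam / 4) ≤ Real.pi / (9 / 5) * B := hcount.trans hI
  have h2 : Real.pi / (9 / 5) * B ≤ (7 / 4) * B := by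
    have : Real.pi / (9 / 5) ≤ 7 / 4 := by rw [div_le_iff₀ (by norm_num)]; linarith
    exact mul_le_mul_of_nonneg_right this hB
  rw [le_div_iff₀ hlam]
  nlinarith [h1, h2]

/-! ### LEMMA 32.3: the tangent reaches height -/

/-- STEP 1: transport bounds the slope of `u`: `u′ = u((h−1)/(ag) − κ)`, `0 ≤ κ ≤ 1/s` (κ = cot s), `0 ≤ u ≤ C₀`,
`g ≥ sA₀/2`, `|h − 1| ≤ aA₀ + η` ⇒ `|u′| ≤ (C₀/s)(3 + 2η/(aA₀))`. -/
theorem u_slope_alg (u up C0 s h g η a A0 κ : ℝ) (hs : 0 < s) (ha : 0 < a) (hA0 : 0 < A0) (hu0 : 0 ≤ u)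
    (huC : u ≤ C0) (hκ0 : 0 ≤ κ) (hκ : κ ≤ 1 / s) (hg : s * A0 / 2 ≤ g) (hh : |h - 1| ≤ a * A0 + η) (hη : 0 ≤ η)
    (hup : up = u * ((h - 1) / (a * g) - κ)) :
    |up| ≤ C0 / s * (3 + 2 * η / (a * A0)) := by
  have hgpos : 0 < g := lt_of_lt_of_le (by positivity) hg
  have hag : 0 < a * g := by positivity
  -- |(h-1)/(ag) - κ| ≤ |h-1|/(ag) + κ ≤ (aA0+η)/(a s A0/2) + 1/s
  have hq : |(h - 1) / (a * g) - κ| ≤ (a * A0 + η) / (a * (s * A0 / 2)) + 1 / s := by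
    have t1 : |(h - 1) / (a * g) - κ| ≤ |(h - 1) / (a * g)| + |κ| := abs_sub _ _
    have t2 : |(h - 1) / (a * g)| = |h - 1| / (a * g) := by rw [abs_div, abs_of_pos hag]
    have t3 : |h - 1| / (a * g) ≤ (a * A0 + η) / (a * g) := div_le_div_of_nonneg_right hh hag.le
    have t4 : (a * A0 + η) / (a * g) ≤ (a * A0 + η) / (a * (s * A0 / 2)) := by
      apply div_le_div_of_nonneg_left (by positivity) (by positivity)
      exact mul_le_mul_of_nonneg_left hg ha.le
    have t5 : |κ| = κ := abs_of_nonneg hκ0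
    linarith [t1, t2, t3, t4, t5, hκ]
  have e : (a * A0 + η) / (a * (s * A0 / 2)) + 1 / s = (1 / s) * (3 + 2 * η / (a * A0)) := by
    field_simp; ring
  rw [e] at hq
  rw [hup, abs_mul, abs_of_nonneg hu0]
  calc u * |(h - 1) / (a * g) - κ| ≤ C0 * (1 / s * (3 + 2 * η / (a * A0))) := by
        apply mul_le_mul huC hq (abs_nonneg _) (hu0.trans huC)
    _ = C0 / s * (3 + 2 * η / (a * A0)) := by ring

/-- STEP 1, (32.6): `|G′| ≤ 2|u′| + C₀s`, `|u′| ≤ (C₀/s)(3 + 2η/(aA₀))`, `0 < s ≤ 1/2` ⇒ `|G′| ≤ (C₀/s)(6.25 + 4η/(aA₀))`. -/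
theorem G_slope_alg (Gp up C0 s η a A0 : ℝ) (hs : 0 < s) (hs2 : s ≤ 1 / 2) (hC0 : 0 ≤ C0) (ha : 0 < a)
    (hA0 : 0 < A0) (hη : 0 ≤ η) (hG : |Gp| ≤ 2 * |up| + C0 * s) (hu : |up| ≤ C0 / s * (3 + 2 * η / (a * A0))) :
    |Gp| ≤ C0 / s * (25 / 4 + 4 * η / (a * A0)) := by
  have h1 : C0 * s ≤ C0 / s * (1 / 4) := by
    rw [div_mul_eq_mul_div, le_div_iff₀ hs]
    have hq : 0 ≤ C0 * ((1 / 2 - s) * (1 / 2 + s)) :=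
      mul_nonneg hC0 (mul_nonneg (by linarith) (by linarith))
    nlinarith [hq]
  have hpos : 0 ≤ 2 * η / (a * A0) := by positivity
  have e : C0 / s * (25 / 4 + 4 * η / (a * A0)) = 2 * (C0 / s * (3 + 2 * η / (a * A0))) + C0 / s * (1 / 4) := by ring
  rw [e]; linarith

/-- STEP 2, T₁: `1 − cos x = 2(1 − c)(1 + c)` and `cos(x/2) − cos x = (1 − c)(1 + 2c)`, `c = cos(x/2)`. -/
theorem one_sub_cos_eq (x : ℝ) : 1 - Real.cos x = 2 * (1 - Real.cos (x / 2)) * (1 + Real.cos (x / 2)) := by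
  have h := Real.cos_two_mul (x / 2)
  rw [show 2 * (x / 2) = x by ring] at h
  rw [h]; ring

end Summit.NavierStokesRegularity.OSWSelfSimilar.Mechanism.FirstCritFloor
end
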